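import Mathlib
import HarnessLib
import Summits.HubbardSuperconductivity.HubbardSuperconductivity.Theorems.KLProgrammeKLRegimeFatMultiplierIncrementRelJets
import Summits.HubbardSuperconductivity.HubbardSuperconductivity.Theorems.KLProgrammeKLRegimeFatMultiplierIncrementRelJetsTwoScale
import Summits.HubbardSuperconductivity.HubbardSuperconductivity.Theorems.KLProgrammePerturbedFermiCurveHigherDerivsRegime

/-!
# Route `KLProgramme` — crux K3 ENGINE (stmt-HubbardSuperconductivity-20437) stub (b) conj. 2 «(c-D)² FAMILY TELESCOPE», brick (D5-prep 3a): the increment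
# pair's line data, co-factor jets and time bounds in RELATIVE SCALE FORM from INEQUALITY line data

Cell `gate-hubbard-kl`, seat hubbard-kl-k3c3-p2 (g11); F1-DESIGN §8/§10, feeding `slicePairWt_charSum_l1_le_famIncrScale` (`…SectorSlicePairFamIncrScale`).
The sampled increment-pair instances (`…IncrementPairSpace/Time/Tangent`) bound `‖Δ¹‖ ≤ 𝔅₁q₀ + 𝔅₀q₁`, `‖Δ²‖ ≤ 𝔅₂q₀ + 2𝔅₁q₁ + 𝔅₀q₂`,
`‖Δ³‖ ≤ 𝔅₃q₀ + 3𝔅₂q₁ + 3𝔅₁q₂ + 𝔅₀q₃` with EXACT brackets `D_k, W_k` of the line data `(E₀, E₁, E₂, E₃; P₀, P₁, P₂, P₃)` at the step's own norms; the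
scale class is reached through UPPER BOUNDS `E₁ ≤ tη`, `E₂ ≤ ε₂η²`, `E₃ ≤ (ε₃₀+ε₃₁x)η³`, `P₁ ≤ (G₁/x)η`, `P₂ ≤ G₂η²`, `P₃ ≤ G₃xη³` (`P₀ = G₀/x²` exact, `η` any
common bound of the step's sup and Euclidean norms):

* §1 `incrPair_lineData_scale_le'` — the inequality twin of `incrPair_lineData_twoScale_le` (same nine conclusions);
* §2 `incrPair_cofactor_scale_le` — the co-factor's line jets `q₁ ≤ η𝔮₁`, `q₂ ≤ η²𝔮₂`, `q₃ ≤ η³(𝔮₃₀ + 𝔮₃₁x)`;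
* §3 `incrPair_time_rel_le` — the time Leibniz bounds relative to `𝔅₀`: `≤ 𝔅₀θ_k`, `θ_k` explicit (`x`-free).
(The space combination `incrPair_space_rel_scale_le` is the sequel file `…IncrementRelJetsScale`.)

Pure real algebra; no definitions, no sorry.  Nothing asserts superconductivity. [cite: BenfattoGiulianiMastropietro2006, §3 (3.2)–(3.8)]
-/

noncomputable section

namespace Summit.HubbardSuperconductivity.HubbardSuperconductivity.Theorems.TorusFourierL2

set_option linter.dupNamespace false -- summit = problem name (single-conjunct summit), D-0017

open Summit.HubbardSuperconductivity.HubbardSuperconductivity.Theorems.PerturbedFermiCurve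

/-! ### §1 Line data in the scale class from upper bounds -/

set_option maxHeartbeats 800000 in
/-- **Line data of the increment pair in the two-scale class, from UPPER BOUNDS** (inequality twin of `incrPair_lineData_twoScale_le`):
same nine conclusions `D₁ ≤ 4Λtη`, …, `ω₃ ≤ η³(…)`. [cite: BenfattoGiulianiMastropietro2006, §3 (3.2)] -/
theorem incrPair_lineData_scale_le' {Λ E₀ t ε₂ ε₃₀ ε₃₁ G₀ G₁ G₂ G₃ η x E₁ E₂ E₃ P₀ P₁ P₂ P₃ D₁ D₂ D₃ W₁ W₂ W₃ ω₁ ω₂ ω₃ : ℝ}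
    (hΛ : 0 < Λ) (hE₀l : Λ ≤ E₀) (hE₀u : E₀ ≤ 2 * Λ) (ht : 0 ≤ t) (hε₂ : 0 ≤ ε₂) (hε₃₀ : 0 ≤ ε₃₀) (hε₃₁ : 0 ≤ ε₃₁)
    (hG₀ : 0 < G₀) (hG₁ : 0 ≤ G₁) (hG₂ : 0 ≤ G₂) (hG₃ : 0 ≤ G₃) (hη : 0 ≤ η) (hx : 1 ≤ x)
    (hE₁0 : 0 ≤ E₁) (hE₂0 : 0 ≤ E₂) (hE₃0 : 0 ≤ E₃) (hP₁0 : 0 ≤ P₁) (hP₂0 : 0 ≤ P₂) (hP₃0 : 0 ≤ P₃)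
    (hE₁ : E₁ ≤ t * η) (hE₂ : E₂ ≤ ε₂ * η ^ 2) (hE₃ : E₃ ≤ (ε₃₀ + ε₃₁ * x) * η ^ 3)
    (hP₀ : P₀ = G₀ / x ^ 2) (hP₁ : P₁ ≤ G₁ / x * η) (hP₂ : P₂ ≤ G₂ * η ^ 2) (hP₃ : P₃ ≤ G₃ * x * η ^ 3)
    (hD₁ : D₁ = 2 * E₀ * E₁) (hD₂ : D₂ = 2 * (E₁ ^ 2 + E₀ * E₂)) (hD₃ : D₃ = 2 * (3 * E₁ * E₂ + E₀ * E₃))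
    (hW₁ : W₁ = 2 * (E₁ * P₀ + E₀ * P₁ + P₀ * P₁))
    (hW₂ : W₂ = 2 * (E₂ * P₀ + 2 * E₁ * P₁ + E₀ * P₂ + P₁ ^ 2 + P₀ * P₂))
    (hW₃ : W₃ = 2 * (E₃ * P₀ + 3 * E₂ * P₁ + 3 * E₁ * P₂ + E₀ * P₃ + 3 * P₁ * P₂ + P₀ * P₃))
    (hω₁ : ω₁ = E₁ / E₀ + 2 * P₁ / P₀) (hω₂ : ω₂ = E₂ / E₀ + 2 * E₁ * P₁ / (E₀ * P₀) + 2 * P₂ / P₀ + P₁ ^ 2 / (E₀ * P₀))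
    (hω₃ : ω₃ = E₃ / E₀ + 3 * E₂ * P₁ / (E₀ * P₀) + 3 * E₁ * P₂ / (E₀ * P₀) + 2 * P₃ / P₀ + 3 * P₁ * P₂ / (E₀ * P₀)) :
    D₁ ≤ 4 * Λ * t * η ∧ W₁ ≤ 2 * (t * G₀ + 2 * Λ * G₁ + G₀ * G₁) * η ∧
    D₂ ≤ 2 * (t ^ 2 + 2 * Λ * ε₂) * η ^ 2 ∧ W₂ ≤ 2 * (ε₂ * G₀ + 2 * t * G₁ + 2 * Λ * G₂ + G₁ ^ 2 + G₀ * G₂) * η ^ 2 ∧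
    D₃ ≤ (2 * (3 * t * ε₂ + 2 * Λ * ε₃₀) + 4 * Λ * ε₃₁ * x) * η ^ 3 ∧
    W₃ ≤ (2 * (ε₃₀ * G₀ + ε₃₁ * G₀ + 3 * ε₂ * G₁ + 3 * t * G₂ + 3 * G₁ * G₂ + G₀ * G₃) + 4 * Λ * G₃ * x) * η ^ 3 ∧
    ω₁ ≤ η * (t / Λ + 2 * G₁ / G₀ * x) ∧
    ω₂ ≤ η ^ 2 * ((ε₂ / Λ + G₁ ^ 2 / (Λ * G₀)) + 2 * t * G₁ / (Λ * G₀) * x + 2 * G₂ / G₀ * x ^ 2) ∧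
    ω₃ ≤ η ^ 3 * (ε₃₀ / Λ + (ε₃₁ / Λ + 3 * ε₂ * G₁ / (Λ * G₀) + 3 * G₁ * G₂ / (Λ * G₀)) * x + 3 * t * G₂ / (Λ * G₀) * x ^ 2 +
      2 * G₃ / G₀ * x ^ 3) := by
  have hx0 : 0 < x := lt_of_lt_of_le one_pos hx
  have hE0 : 0 < E₀ := lt_of_lt_of_le hΛ hE₀l
  have hx1 : 1 ≤ x ^ 2 := one_le_pow₀ hx
  have hix : 1 / x ≤ 1 := by rw [div_le_one hx0]; exact hx
  have hix2 : 1 / x ^ 2 ≤ 1 := by rw [div_le_one (by positivity)]; exact hx1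
  have hP0pos : 0 < P₀ := by rw [hP₀]; positivity
  have hP0 : 0 ≤ P₀ := hP0pos.le
  have bP₀ : P₀ ≤ G₀ := by
    rw [hP₀, show G₀ / x ^ 2 = G₀ * (1 / x ^ 2) by ring]
    exact (mul_le_mul_of_nonneg_left hix2 hG₀.le).trans (le_of_eq (mul_one _))
  have bG₁x : G₁ / x * η ≤ G₁ * η := by
    rw [show G₁ / x * η = G₁ * η * (1 / x) by ring]
    exact (mul_le_mul_of_nonneg_left hix (by positivity)).trans (le_of_eq (mul_one _))
  have bP₁ : P₁ ≤ G₁ * η := hP₁.trans bG₁x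
  have htη : 0 ≤ t * η := by positivity
  have hG₁η : 0 ≤ G₁ * η := by positivity
  have hΛP : 0 < Λ * P₀ := mul_pos hΛ hP0pos
  have hEP : Λ * P₀ ≤ E₀ * P₀ := mul_le_mul_of_nonneg_right hE₀l hP0
  refine ⟨?_, ?_, ?_, ?_, ?_, ?_, ?_, ?_, ?_⟩
  · -- D₁
    rw [hD₁]
    have := mul_le_mul hE₀u hE₁ hE₁0 (by positivity)
    linarith only [this]
  · -- W₁
    rw [hW₁]
    have t1 : E₁ * P₀ ≤ t * η * G₀ := mul_le_mul hE₁ bP₀ hP0 htη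
    have t2 : E₀ * P₁ ≤ 2 * Λ * (G₁ * η) := mul_le_mul hE₀u bP₁ hP₁0 (by positivity)
    have t3 : P₀ * P₁ ≤ G₀ * (G₁ * η) := mul_le_mul bP₀ bP₁ hP₁0 hG₀.le
    linarith only [t1, t2, t3]
  · -- D₂
    rw [hD₂]
    have t1 : E₁ ^ 2 ≤ (t * η) ^ 2 := pow_le_pow_left₀ hE₁0 hE₁ 2
    have t2 : E₀ * E₂ ≤ 2 * Λ * (ε₂ * η ^ 2) := mul_le_mul hE₀u hE₂ hE₂0 (by positivity)
    linarith only [t1, t2]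
  · -- W₂
    rw [hW₂]
    have t1 : E₂ * P₀ ≤ ε₂ * η ^ 2 * G₀ := mul_le_mul hE₂ bP₀ hP0 (by positivity)
    have t2 : E₁ * P₁ ≤ t * η * (G₁ * η) := mul_le_mul hE₁ bP₁ hP₁0 htη
    have t3 : E₀ * P₂ ≤ 2 * Λ * (G₂ * η ^ 2) := mul_le_mul hE₀u hP₂ hP₂0 (by positivity)
    have t4 : P₁ ^ 2 ≤ (G₁ * η) ^ 2 := pow_le_pow_left₀ hP₁0 bP₁ 2
    have t5 : P₀ * P₂ ≤ G₀ * (G₂ * η ^ 2) := mul_le_mul bP₀ hP₂ hP₂0 hG₀.le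
    linarith only [t1, t2, t3, t4, t5]
  · -- D₃
    rw [hD₃]
    have t1 : E₁ * E₂ ≤ t * η * (ε₂ * η ^ 2) := mul_le_mul hE₁ hE₂ hE₂0 htη
    have t2 : E₀ * E₃ ≤ 2 * Λ * ((ε₃₀ + ε₃₁ * x) * η ^ 3) := mul_le_mul hE₀u hE₃ hE₃0 (by positivity)
    linarith only [t1, t2]
  · -- W₃
    rw [hW₃]
    have hxP : (ε₃₀ + ε₃₁ * x) * P₀ ≤ (ε₃₀ + ε₃₁) * G₀ := by
      rw [hP₀]
      have hG0x : G₀ / x ^ 2 ≤ G₀ := by have h := bP₀; rw [hP₀] at h; exact h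
      have h1 : ε₃₀ * (G₀ / x ^ 2) ≤ ε₃₀ * G₀ := mul_le_mul_of_nonneg_left hG0x hε₃₀
      have h2 : ε₃₁ * x * (G₀ / x ^ 2) ≤ ε₃₁ * G₀ := by
        have e : ε₃₁ * x * (G₀ / x ^ 2) = ε₃₁ * G₀ * (1 / x) := by field_simp
        rw [e]; exact (mul_le_mul_of_nonneg_left hix (by positivity)).trans (le_of_eq (mul_one _))
      linarith only [h1, h2]
    have t1 : E₃ * P₀ ≤ (ε₃₀ + ε₃₁) * G₀ * η ^ 3 := by
      have h := mul_le_mul_of_nonneg_right hE₃ hP0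
      rw [show (ε₃₀ + ε₃₁ * x) * η ^ 3 * P₀ = ((ε₃₀ + ε₃₁ * x) * P₀) * η ^ 3 by ring] at h
      exact h.trans (mul_le_mul_of_nonneg_right hxP (by positivity))
    have t2 : E₂ * P₁ ≤ ε₂ * η ^ 2 * (G₁ * η) := mul_le_mul hE₂ bP₁ hP₁0 (by positivity)
    have t3 : E₁ * P₂ ≤ t * η * (G₂ * η ^ 2) := mul_le_mul hE₁ hP₂ hP₂0 htη
    have t4 : E₀ * P₃ ≤ 2 * Λ * (G₃ * x * η ^ 3) := mul_le_mul hE₀u hP₃ hP₃0 (by positivity)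
    have t5 : P₁ * P₂ ≤ G₁ * η * (G₂ * η ^ 2) := mul_le_mul bP₁ hP₂ hP₂0 hG₁η
    have t6 : P₀ * P₃ ≤ G₀ * G₃ * η ^ 3 := by
      have h : P₀ * P₃ ≤ P₀ * (G₃ * x * η ^ 3) := mul_le_mul_of_nonneg_left hP₃ hP0
      refine h.trans ?_
      rw [hP₀]
      have e : G₀ / x ^ 2 * (G₃ * x * η ^ 3) = G₀ * G₃ * η ^ 3 * (1 / x) := by field_simp
      rw [e]; exact (mul_le_mul_of_nonneg_left hix (by positivity)).trans (le_of_eq (mul_one _))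
    linarith only [t1, t2, t3, t4, t5, t6]
  · -- ω₁
    rw [hω₁]
    have t1 : E₁ / E₀ ≤ t * η / Λ := div_relax hE₁ htη hΛ hE₀l
    have t2 : 2 * P₁ / P₀ ≤ 2 * (G₁ / x * η) / P₀ := div_le_div_of_nonneg_right (by linarith only [hP₁]) hP0
    have e : 2 * (G₁ / x * η) / P₀ = η * (2 * G₁ / G₀ * x) := by rw [hP₀]; field_simp
    have e1 : t * η / Λ = η * (t / Λ) := by ring
    rw [e] at t2
    linarith only [t1, t2, e1]
  · -- ω₂
    rw [hω₂]
    have t1 : E₂ / E₀ ≤ ε₂ * η ^ 2 / Λ := div_relax hE₂ (by positivity) hΛ hE₀l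
    have t2 : 2 * E₁ * P₁ / (E₀ * P₀) ≤ 2 * (t * η) * (G₁ / x * η) / (Λ * P₀) :=
      div_relax (by have h := mul_le_mul hE₁ hP₁ hP₁0 htη; linarith only [h]) (by positivity) hΛP hEP
    have e2 : 2 * (t * η) * (G₁ / x * η) / (Λ * P₀) = η ^ 2 * (2 * t * G₁ / (Λ * G₀) * x) := by rw [hP₀]; field_simp
    have t3 : 2 * P₂ / P₀ ≤ 2 * (G₂ * η ^ 2) / P₀ := div_le_div_of_nonneg_right (by linarith only [hP₂]) hP0
    have e3 : 2 * (G₂ * η ^ 2) / P₀ = η ^ 2 * (2 * G₂ / G₀ * x ^ 2) := by rw [hP₀]; field_simp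
    have t4 : P₁ ^ 2 / (E₀ * P₀) ≤ (G₁ / x * η) ^ 2 / (Λ * P₀) :=
      div_relax (pow_le_pow_left₀ hP₁0 hP₁ 2) (by positivity) hΛP hEP
    have e4 : (G₁ / x * η) ^ 2 / (Λ * P₀) = η ^ 2 * (G₁ ^ 2 / (Λ * G₀)) := by rw [hP₀]; field_simp
    rw [e2] at t2; rw [e3] at t3; rw [e4] at t4
    have e : η ^ 2 * ((ε₂ / Λ + G₁ ^ 2 / (Λ * G₀)) + 2 * t * G₁ / (Λ * G₀) * x + 2 * G₂ / G₀ * x ^ 2) =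
        ε₂ * η ^ 2 / Λ + η ^ 2 * (2 * t * G₁ / (Λ * G₀) * x) + η ^ 2 * (2 * G₂ / G₀ * x ^ 2) + η ^ 2 * (G₁ ^ 2 / (Λ * G₀)) := by ring
    rw [e]; linarith only [t1, t2, t3, t4]
  · -- ω₃
    rw [hω₃]
    have t1 : E₃ / E₀ ≤ (ε₃₀ + ε₃₁ * x) * η ^ 3 / Λ := div_relax hE₃ (by positivity) hΛ hE₀l
    have t2 : 3 * E₂ * P₁ / (E₀ * P₀) ≤ 3 * (ε₂ * η ^ 2) * (G₁ / x * η) / (Λ * P₀) :=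
      div_relax (by have h := mul_le_mul hE₂ hP₁ hP₁0 (by positivity : 0 ≤ ε₂ * η ^ 2); linarith only [h]) (by positivity) hΛP hEP
    have e2 : 3 * (ε₂ * η ^ 2) * (G₁ / x * η) / (Λ * P₀) = η ^ 3 * (3 * ε₂ * G₁ / (Λ * G₀) * x) := by rw [hP₀]; field_simp
    have t3 : 3 * E₁ * P₂ / (E₀ * P₀) ≤ 3 * (t * η) * (G₂ * η ^ 2) / (Λ * P₀) :=
      div_relax (by have h := mul_le_mul hE₁ hP₂ hP₂0 htη; linarith only [h]) (by positivity) hΛP hEP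
    have e3 : 3 * (t * η) * (G₂ * η ^ 2) / (Λ * P₀) = η ^ 3 * (3 * t * G₂ / (Λ * G₀) * x ^ 2) := by rw [hP₀]; field_simp
    have t4 : 2 * P₃ / P₀ ≤ 2 * (G₃ * x * η ^ 3) / P₀ := div_le_div_of_nonneg_right (by linarith only [hP₃]) hP0
    have e4 : 2 * (G₃ * x * η ^ 3) / P₀ = η ^ 3 * (2 * G₃ / G₀ * x ^ 3) := by rw [hP₀]; field_simp
    have t5 : 3 * P₁ * P₂ / (E₀ * P₀) ≤ 3 * (G₁ / x * η) * (G₂ * η ^ 2) / (Λ * P₀) :=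
      div_relax (by have h := mul_le_mul hP₁ hP₂ hP₂0 (by positivity : 0 ≤ G₁ / x * η); linarith only [h]) (by positivity) hΛP hEP
    have e5 : 3 * (G₁ / x * η) * (G₂ * η ^ 2) / (Λ * P₀) = η ^ 3 * (3 * G₁ * G₂ / (Λ * G₀) * x) := by rw [hP₀]; field_simp
    rw [e2] at t2; rw [e3] at t3; rw [e4] at t4; rw [e5] at t5
    have e : η ^ 3 * (ε₃₀ / Λ + (ε₃₁ / Λ + 3 * ε₂ * G₁ / (Λ * G₀) + 3 * G₁ * G₂ / (Λ * G₀)) * x + 3 * t * G₂ / (Λ * G₀) * x ^ 2 + 2 * G₃ / G₀ * x ^ 3) =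
        (ε₃₀ + ε₃₁ * x) * η ^ 3 / Λ + η ^ 3 * (3 * ε₂ * G₁ / (Λ * G₀) * x) + η ^ 3 * (3 * t * G₂ / (Λ * G₀) * x ^ 2) + η ^ 3 * (2 * G₃ / G₀ * x ^ 3) +
          η ^ 3 * (3 * G₁ * G₂ / (Λ * G₀) * x) := by
      field_simp; ring
    rw [e]; linarith only [t1, t2, t3, t4, t5]

/-! ### §2 The co-factor's line jets in scale form -/

set_option maxHeartbeats 800000 in
/-- **The co-factor's localised line jets in scale form**: the `q₁, q₂, q₃` of `norm_fwdDiff_iter_space_fatIncrPair_le` /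
`norm_fwdDiff_iter_tangent_fatIncrPair_le` (first band slot `τw`, step sup-norm `nw`, angular size `zD`) are `≤ η𝔮₁`, `≤ η²𝔮₂`, `≤ η³(𝔮₃₀ + 𝔮₃₁x)`
as soon as `τw ≤ tη`, `nw ≤ η`, `zD ≤ ζη`, `4 + 8A₃ ≤ ε₃₀ + ε₃₁x`. [cite: BenfattoGiulianiMastropietro2006, §3 (3.2)] -/
theorem incrPair_cofactor_scale_le {g₁ g₂ g₃ Λ Kp A₃ τw nw zD S Ba z₁ z₂ z₃ q₁ q₂ q₃ t η ζ ε₃₀ ε₃₁ x 𝔮₁ 𝔮₂ 𝔮₃₀ 𝔮₃₁ : ℝ}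
    (hg₁ : 0 ≤ g₁) (hg₂ : 0 ≤ g₂) (hg₃ : 0 ≤ g₃) (hΛ : 0 < Λ) (hKp : 0 ≤ Kp) (hS : 0 ≤ S) (hBa : 0 ≤ Ba)
    (hτ0 : 0 ≤ τw) (hnw0 : 0 ≤ nw) (hzD0 : 0 ≤ zD) (ht : 0 ≤ t) (hζ : 0 ≤ ζ) (hε₃₀ : 0 ≤ ε₃₀) (hε₃₁ : 0 ≤ ε₃₁) (hx : 1 ≤ x)
    (hτ : τw ≤ t * η) (hnw : nw ≤ η) (hzD : zD ≤ ζ * η) (hA₃x : 4 + 8 * A₃ ≤ ε₃₀ + ε₃₁ * x)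
    (hz₁ : z₁ = S * (12 * Ba * zD)) (hz₂ : z₂ = S * ((12 * Ba + 72 * Ba ^ 2) * zD ^ 2)) (hz₃ : z₃ = S * ((12 * Ba + 216 * Ba ^ 2) * zD ^ 3))
    (hq₁ : q₁ = 2 * g₁ * τw / Λ * 1 + 1 * z₁)
    (hq₂ : q₂ = ((4 * g₂ + 2 * g₁) * τw ^ 2 / Λ ^ 2 + 2 * g₁ * (Kp * nw ^ 2) / Λ) * 1 + 4 * g₁ * τw / Λ * z₁ + 1 * z₂)
    (hq₃ : q₃ = ((8 * g₃ + 12 * g₂) * τw ^ 3 / Λ ^ 3 + (12 * g₂ + 6 * g₁) * (τw * (Kp * nw ^ 2)) / Λ ^ 2 + 2 * g₁ * ((4 + 8 * A₃) * nw ^ 3) / Λ) * 1 +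
      3 * (((4 * g₂ + 2 * g₁) * τw ^ 2 / Λ ^ 2 + 2 * g₁ * (Kp * nw ^ 2) / Λ) * z₁) + 3 * (2 * g₁ * τw / Λ * z₂) + 1 * z₃)
    (h𝔮₁ : 𝔮₁ = 2 * g₁ * t / Λ + S * (12 * Ba * ζ))
    (h𝔮₂ : 𝔮₂ = (4 * g₂ + 2 * g₁) * t ^ 2 / Λ ^ 2 + 2 * g₁ * Kp / Λ + 4 * g₁ * t / Λ * (S * (12 * Ba * ζ)) + S * ((12 * Ba + 72 * Ba ^ 2) * ζ ^ 2))
    (h𝔮₃₀ : 𝔮₃₀ = (8 * g₃ + 12 * g₂) * t ^ 3 / Λ ^ 3 + (12 * g₂ + 6 * g₁) * (t * Kp) / Λ ^ 2 + 2 * g₁ * ε₃₀ / Λ +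
      3 * (((4 * g₂ + 2 * g₁) * t ^ 2 / Λ ^ 2 + 2 * g₁ * Kp / Λ) * (S * (12 * Ba * ζ))) + 3 * (2 * g₁ * t / Λ * (S * ((12 * Ba + 72 * Ba ^ 2) * ζ ^ 2))) +
      S * ((12 * Ba + 216 * Ba ^ 2) * ζ ^ 3))
    (h𝔮₃₁ : 𝔮₃₁ = 2 * g₁ * ε₃₁ / Λ) :
    q₁ ≤ η * 𝔮₁ ∧ q₂ ≤ η ^ 2 * 𝔮₂ ∧ q₃ ≤ η ^ 3 * (𝔮₃₀ + 𝔮₃₁ * x) ∧ 0 ≤ 𝔮₁ ∧ 0 ≤ 𝔮₂ ∧ 0 ≤ 𝔮₃₀ ∧ 0 ≤ 𝔮₃₁ := by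
  have hη : 0 ≤ η := hnw0.trans hnw
  have htη : 0 ≤ t * η := by positivity
  have hζη : 0 ≤ ζ * η := by positivity
  have hx0 : 0 ≤ x := zero_le_one.trans hx
  -- powers of the slots
  have hτ2 : τw ^ 2 ≤ (t * η) ^ 2 := pow_le_pow_left₀ hτ0 hτ 2
  have hτ3 : τw ^ 3 ≤ (t * η) ^ 3 := pow_le_pow_left₀ hτ0 hτ 3
  have hn2 : nw ^ 2 ≤ η ^ 2 := pow_le_pow_left₀ hnw0 hnw 2
  have hn3 : nw ^ 3 ≤ η ^ 3 := pow_le_pow_left₀ hnw0 hnw 3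
  have hzD2 : zD ^ 2 ≤ (ζ * η) ^ 2 := pow_le_pow_left₀ hzD0 hzD 2
  have hzD3 : zD ^ 3 ≤ (ζ * η) ^ 3 := pow_le_pow_left₀ hzD0 hzD 3
  have bz₁ : z₁ ≤ S * (12 * Ba * (ζ * η)) := by rw [hz₁]; gcongr
  have bz₂ : z₂ ≤ S * ((12 * Ba + 72 * Ba ^ 2) * (ζ * η) ^ 2) := by rw [hz₂]; gcongr
  have bz₃ : z₃ ≤ S * ((12 * Ba + 216 * Ba ^ 2) * (ζ * η) ^ 3) := by rw [hz₃]; gcongr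
  have hz₁0 : 0 ≤ z₁ := by rw [hz₁]; positivity
  have hz₂0 : 0 ≤ z₂ := by rw [hz₂]; positivity
  -- the building blocks
  have a1 : 2 * g₁ * τw / Λ ≤ 2 * g₁ * (t * η) / Λ := by gcongr
  have a10 : 0 ≤ 2 * g₁ * τw / Λ := by positivity
  have a2 : (4 * g₂ + 2 * g₁) * τw ^ 2 / Λ ^ 2 ≤ (4 * g₂ + 2 * g₁) * (t * η) ^ 2 / Λ ^ 2 := by gcongr
  have a3 : 2 * g₁ * (Kp * nw ^ 2) / Λ ≤ 2 * g₁ * (Kp * η ^ 2) / Λ := by gcongr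
  have a23 : 0 ≤ (4 * g₂ + 2 * g₁) * τw ^ 2 / Λ ^ 2 + 2 * g₁ * (Kp * nw ^ 2) / Λ := by positivity
  have a4 : (8 * g₃ + 12 * g₂) * τw ^ 3 / Λ ^ 3 ≤ (8 * g₃ + 12 * g₂) * (t * η) ^ 3 / Λ ^ 3 := by gcongr
  have a5 : (12 * g₂ + 6 * g₁) * (τw * (Kp * nw ^ 2)) / Λ ^ 2 ≤ (12 * g₂ + 6 * g₁) * (t * η * (Kp * η ^ 2)) / Λ ^ 2 := by gcongr
  have a6 : 2 * g₁ * ((4 + 8 * A₃) * nw ^ 3) / Λ ≤ 2 * g₁ * ((ε₃₀ + ε₃₁ * x) * η ^ 3) / Λ := by gcongr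
  refine ⟨?_, ?_, ?_, ?_, ?_, ?_, ?_⟩
  · rw [hq₁, h𝔮₁]
    have e : η * (2 * g₁ * t / Λ + S * (12 * Ba * ζ)) = 2 * g₁ * (t * η) / Λ + S * (12 * Ba * (ζ * η)) := by ring
    rw [e]; linarith only [a1, bz₁]
  · rw [hq₂, h𝔮₂]
    have p1 : 4 * g₁ * τw / Λ * z₁ ≤ 4 * g₁ * (t * η) / Λ * (S * (12 * Ba * (ζ * η))) :=
      mul_le_mul (by gcongr) bz₁ hz₁0 (by positivity)
    have e : η ^ 2 * ((4 * g₂ + 2 * g₁) * t ^ 2 / Λ ^ 2 + 2 * g₁ * Kp / Λ + 4 * g₁ * t / Λ * (S * (12 * Ba * ζ)) + S * ((12 * Ba + 72 * Ba ^ 2) * ζ ^ 2)) =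
        ((4 * g₂ + 2 * g₁) * (t * η) ^ 2 / Λ ^ 2 + 2 * g₁ * (Kp * η ^ 2) / Λ) + 4 * g₁ * (t * η) / Λ * (S * (12 * Ba * (ζ * η))) +
          S * ((12 * Ba + 72 * Ba ^ 2) * (ζ * η) ^ 2) := by ring
    rw [e]; linarith only [a2, a3, p1, bz₂]
  · rw [hq₃, h𝔮₃₀, h𝔮₃₁]
    have p1 : ((4 * g₂ + 2 * g₁) * τw ^ 2 / Λ ^ 2 + 2 * g₁ * (Kp * nw ^ 2) / Λ) * z₁ ≤
        ((4 * g₂ + 2 * g₁) * (t * η) ^ 2 / Λ ^ 2 + 2 * g₁ * (Kp * η ^ 2) / Λ) * (S * (12 * Ba * (ζ * η))) :=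
      mul_le_mul (add_le_add a2 a3) bz₁ hz₁0 (by positivity)
    have p2 : 2 * g₁ * τw / Λ * z₂ ≤ 2 * g₁ * (t * η) / Λ * (S * ((12 * Ba + 72 * Ba ^ 2) * (ζ * η) ^ 2)) := mul_le_mul a1 bz₂ hz₂0 (by positivity)
    have e : η ^ 3 * ((8 * g₃ + 12 * g₂) * t ^ 3 / Λ ^ 3 + (12 * g₂ + 6 * g₁) * (t * Kp) / Λ ^ 2 + 2 * g₁ * ε₃₀ / Λ +
          3 * (((4 * g₂ + 2 * g₁) * t ^ 2 / Λ ^ 2 + 2 * g₁ * Kp / Λ) * (S * (12 * Ba * ζ))) + 3 * (2 * g₁ * t / Λ * (S * ((12 * Ba + 72 * Ba ^ 2) * ζ ^ 2))) +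
          S * ((12 * Ba + 216 * Ba ^ 2) * ζ ^ 3) + 2 * g₁ * ε₃₁ / Λ * x) =
        ((8 * g₃ + 12 * g₂) * (t * η) ^ 3 / Λ ^ 3 + (12 * g₂ + 6 * g₁) * (t * η * (Kp * η ^ 2)) / Λ ^ 2 + 2 * g₁ * ((ε₃₀ + ε₃₁ * x) * η ^ 3) / Λ) +
          3 * (((4 * g₂ + 2 * g₁) * (t * η) ^ 2 / Λ ^ 2 + 2 * g₁ * (Kp * η ^ 2) / Λ) * (S * (12 * Ba * (ζ * η)))) +
          3 * (2 * g₁ * (t * η) / Λ * (S * ((12 * Ba + 72 * Ba ^ 2) * (ζ * η) ^ 2))) + S * ((12 * Ba + 216 * Ba ^ 2) * (ζ * η) ^ 3) := by ring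
    rw [e]; linarith only [a4, a5, a6, p1, p2, bz₃]
  · rw [h𝔮₁]; positivity
  · rw [h𝔮₂]; positivity
  · rw [h𝔮₃₀]; positivity
  · rw [h𝔮₃₁]; positivity

/-! ### §3 Time differences relative to the amplitude -/

/-- **Time Leibniz bounds relative to `𝔅₀`** (the brackets of `norm_fwdDiff_iter_time_fatIncrPair_le` with `C_{k+1} = κ^kC₁`): the three bounds are
`𝔅₀·θ_k` with `θ₁ = κD₁ + q₁`, `θ₂ = κ²D₁² + κD₂ + 2κD₁q₁ + q₂`, `θ₃ = κ³D₁³ + 3κ²D₁D₂ + 3(κ²D₁² + κD₂)q₁ + 3κD₁q₂ + q₃`.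
[cite: BenfattoGiulianiMastropietro2006, §3 (3.2)] -/
theorem incrPair_time_rel_le {κ C₁ C₂ C₃ C₄ W₀ D₁ D₂ B₀ B₁ B₂ B₃ q₁ q₂ q₃ n₁ n₂ n₃ θ₁ θ₂ θ₃ : ℝ}
    (hC₂ : C₂ = κ * C₁) (hC₃ : C₃ = κ ^ 2 * C₁) (hC₄ : C₄ = κ ^ 3 * C₁)
    (hB₀ : B₀ = C₁ * W₀) (hB₁ : B₁ = C₂ * W₀ * D₁) (hB₂ : B₂ = C₃ * W₀ * D₁ ^ 2 + C₂ * W₀ * D₂) (hB₃ : B₃ = C₄ * W₀ * D₁ ^ 3 + 3 * (C₃ * W₀ * (D₁ * D₂)))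
    (h₁ : n₁ ≤ B₁ * 1 + B₀ * q₁) (h₂ : n₂ ≤ B₂ * 1 + 2 * (B₁ * q₁) + B₀ * q₂) (h₃ : n₃ ≤ B₃ * 1 + 3 * (B₂ * q₁) + 3 * (B₁ * q₂) + B₀ * q₃)
    (hθ₁ : θ₁ = κ * D₁ + q₁) (hθ₂ : θ₂ = κ ^ 2 * D₁ ^ 2 + κ * D₂ + 2 * (κ * D₁) * q₁ + q₂)
    (hθ₃ : θ₃ = κ ^ 3 * D₁ ^ 3 + 3 * (κ ^ 2 * (D₁ * D₂)) + 3 * ((κ ^ 2 * D₁ ^ 2 + κ * D₂) * q₁) + 3 * (κ * D₁ * q₂) + q₃) :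
    n₁ ≤ B₀ * θ₁ ∧ n₂ ≤ B₀ * θ₂ ∧ n₃ ≤ B₀ * θ₃ := by
  subst hC₂ hC₃ hC₄ hB₀ hB₁ hB₂ hB₃ hθ₁ hθ₂ hθ₃
  exact ⟨h₁.trans_eq (by ring), h₂.trans_eq (by ring), h₃.trans_eq (by ring)⟩

end Summit.HubbardSuperconductivity.HubbardSuperconductivity.Theorems.TorusFourierL2

end
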